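import Mathlib.RingTheory.Unramified.Field
import Mathlib.RingTheory.Flat.Basic
import Mathlib.FieldTheory.SeparableDegree
import Mathlib.LinearAlgebra.TensorProduct.Tower
import HarnessLib

/-!
# [OURS · L1 W4.2] K2-sep ROUTE A, brick (α): **a separable algebraic extension is geometrically reduced — `IsReduced (L ⊗ₖ K)` for `L/k`
# separable algebraic of ANY degree and ANY field extension `K/k`** (EGA IV₂ (4.3.5)/(4.6.1); the finite case is Mathlib's
# `Algebra.FormallyUnramified.isReduced_of_field`, the general case by finitely generated sub-extensions)
# (crux `SigmaMaxModifications` stmt-ResolutionOfSingularities-18506 / conjunct stmt-…-19249; line `w_ladder_rows` v8.5, registered stub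
# `stub_isoSepRecurrent`; res-L1-w42-plan-1 WORD 2026-08-27T16:25:47Z «tower base change to k^sep»; design
# `L/res-L1-w42-stub-2/k2sep/K2SEP-DESIGN.md` brick (α))

Prover res-L1-w42-stub-2 (gen 5). Helper file `--supports stmt-ResolutionOfSingularities-19249 --as helper`; pure commutative algebra over
Mathlib, no definitions, no named fact. OURS (cell res-hironaka, slot W4.2); NOT statements of [Hironaka2017] nor of [CossartJannsenSaito2020].
AI-written; AI review is weaker than expert review.

WHY (Route A of the K2-sep object): the ground-field base change `X_n ×_k K` of the stages of an isolated point tower along a SEPARABLE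
algebraic `K/k` (e.g. `K = k^sep`, infinite over `k`) must stay REDUCED (maximal origins are reduced) and the centres `Spec(κ(x_n) ⊗_k K)`
must be reduced finite sets of points; both come from this file's lemma with the roles `L := K` (separable) and `K := ` an arbitrary
field over `k` (a residue field, a fraction field of a component).

* `isReduced_tensorProduct_of_isSeparable_of_finiteDimensional'` — the finite case (Mathlib, recorded in the orientation `L ⊗ₖ K`);
* **`isReduced_tensorProduct_of_isSeparable`** — `L/k` separable algebraic (any degree), `K/k` any field extension ⟹ `L ⊗ₖ K` reduced:
  a nilpotent tensor lies in `L₀ ⊗ₖ K` for a finitely generated (hence finite separable) intermediate field `L₀`, and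
  `L₀ ⊗ₖ K → L ⊗ₖ K` is injective (`K` is flat over the field `k`);
* `isReduced_tensorProduct_of_isSeparable_left` — the same in the orientation `K ⊗ₖ L`.

[OURS · L1 W4.2; AI-written] [cite: GrothendieckDieudonne1965, Prop. (4.3.5), Prop. (4.6.1)]
-/

set_option linter.dupNamespace false

noncomputable section

open scoped TensorProduct

namespace Summit.ResolutionOfSingularities.ResolutionOfSingularities.Theorems.SigmaMaxModificationsCorridor3.IsoTailsHS

universe u v w

/-- **EGA IV₂ (4.3.5), finite case** (Mathlib: a finite separable extension is formally unramified, and an unramified algebra essentially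
of finite type over a field is reduced — here over the field `K` after base change). [cite: GrothendieckDieudonne1965, Prop. (4.3.5)] -/
theorem isReduced_tensorProduct_of_isSeparable_of_finiteDimensional' (k : Type u) (L : Type v) (K : Type w) [Field k] [Field L]
    [Algebra k L] [Field K] [Algebra k K] [Algebra.IsSeparable k L] [FiniteDimensional k L] : IsReduced (L ⊗[k] K) := by
  haveI : Algebra.FormallyUnramified k L := Algebra.FormallyUnramified.of_isSeparable k L
  haveI : IsReduced (K ⊗[k] L) := Algebra.FormallyUnramified.isReduced_of_field K (K ⊗[k] L)
  exact isReduced_of_injective (Algebra.TensorProduct.comm k L K).toRingEquiv (Algebra.TensorProduct.comm k L K).injective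

/-- **A SEPARABLE ALGEBRAIC EXTENSION IS GEOMETRICALLY REDUCED** (EGA IV₂ (4.6.1)): for `L/k` separable algebraic of ANY degree and ANY field
extension `K/k`, `L ⊗ₖ K` is reduced. A nilpotent `x = Σ lᵢ ⊗ kᵢ` lies in the image of `L₀ ⊗ₖ K`, `L₀ = k(l₁, …, l_r)` finite separable; the
map `L₀ ⊗ₖ K → L ⊗ₖ K` is injective (`K` flat over `k`), so the preimage is nilpotent in the reduced ring `L₀ ⊗ₖ K`, hence zero.
[cite: GrothendieckDieudonne1965, Prop. (4.6.1)] -/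
theorem isReduced_tensorProduct_of_isSeparable (k : Type u) (L : Type v) (K : Type w) [Field k] [Field L] [Algebra k L] [Field K]
    [Algebra k K] [Algebra.IsSeparable k L] : IsReduced (L ⊗[k] K) := by
  classical
  refine ⟨fun x hx => ?_⟩
  obtain ⟨S, rfl⟩ := TensorProduct.exists_finset x
  -- the statement for an arbitrary finite intermediate field containing the left legs
  have key : ∀ (L₀ : IntermediateField k L), FiniteDimensional k L₀ → (∀ p ∈ S, p.1 ∈ L₀) →
      (∑ p ∈ S, p.1 ⊗ₜ[k] p.2 : L ⊗[k] K) = 0 := by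
    intro L₀ _ hmem
    -- the preimage in `L₀ ⊗ K`
    let f := Algebra.TensorProduct.map L₀.val (AlgHom.id k K)
    let y : L₀ ⊗[k] K := ∑ p ∈ S.attach, (⟨p.1.1, hmem p.1 p.2⟩ : L₀) ⊗ₜ[k] p.1.2
    have hfy : f y = ∑ p ∈ S, p.1 ⊗ₜ[k] p.2 := by
      simp only [y, f, map_sum, Algebra.TensorProduct.map_tmul, IntermediateField.val_mk, AlgHom.coe_id, id_eq]
      exact Finset.sum_attach S fun p => p.1 ⊗ₜ[k] p.2
    -- `f` is injective: `K` is flat over the field `k`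
    have hf : Function.Injective f := by
      have h : Function.Injective ((L₀.val.toLinearMap).rTensor K) :=
        Module.Flat.rTensor_preserves_injective_linearMap (M := K) L₀.val.toLinearMap Subtype.val_injective
      intro a b hab
      exact h hab
    -- conclude in the reduced finite case
    haveI : IsReduced (L₀ ⊗[k] K) := isReduced_tensorProduct_of_isSeparable_of_finiteDimensional' k L₀ K
    obtain ⟨n, hn⟩ := hx
    have hfn : f (y ^ n) = f 0 := by rw [map_pow f y n, hfy, hn, map_zero]
    have hy : y = 0 := IsNilpotent.eq_zero ⟨n, hf hfn⟩
    rw [← hfy, hy, map_zero]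
  refine key (IntermediateField.adjoin k ((S.image Prod.fst : Finset L) : Set L))
    (IntermediateField.finiteDimensional_adjoin fun l _ => Algebra.IsIntegral.isIntegral (R := k) l) fun p hp => ?_
  exact IntermediateField.subset_adjoin k _ (Finset.mem_coe.mpr (Finset.mem_image_of_mem Prod.fst hp))

/-- The same in the orientation `K ⊗ₖ L` (the shape `𝒪 ⊗ₖ K`-fibres / `κ(x) ⊗ₖ K` take when `K/k` is the separable factor).
[cite: GrothendieckDieudonne1965, Prop. (4.6.1)] -/
theorem isReduced_tensorProduct_of_isSeparable_left (k : Type u) (K : Type v) (F : Type w) [Field k] [Field K] [Algebra k K]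
    [Algebra.IsSeparable k K] [Field F] [Algebra k F] : IsReduced (F ⊗[k] K) := by
  haveI := isReduced_tensorProduct_of_isSeparable k K F
  exact isReduced_of_injective (Algebra.TensorProduct.comm k F K).toRingEquiv (Algebra.TensorProduct.comm k F K).injective

end Summit.ResolutionOfSingularities.ResolutionOfSingularities.Theorems.SigmaMaxModificationsCorridor3.IsoTailsHS

end
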